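import Literature.AlgebraicGeometry.Modules.EquivariantStructure
import Literature.AlgebraicGeometry.Modules.PullbackFrame
import Literature.AlgebraicGeometry.Modules.PullbackAffineChart
import Literature.AlgebraicGeometry.HodgeTheory.CotangentSheafPullbackHom
import Literature.AlgebraicGeometry.Modules.SheafHom
import HarnessLib

/-!
# Restriction of `G`-linearisations along an equivariant morphism

Layer `Literature/AlgebraicGeometry/Modules`, namespace `Literature.AlgebraicGeometry.RelativeSpec.ActionOver` (continuing
★ `Modules/EquivariantStructure`). THEOREMS and two plumbing `def`s with bodies (morphisms; no `Prop` is asserted); no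
named fact, no instance, no notation. Cell `hodgecm-mathlib` (D-0151), M1PRIME-DAG rung 0, J0a junction, leaf (J0a-2)(c1)
(B-p07 lineage): Mumford's normalisation of the `K(Θ)`-linearisation of `Λ(𝒪(Θ))` along the stable slice `{0} × A`
([MumfordAV1970] §8 pp. 78–80) restricts a would-be linearisation of `Λ` on `A × A` to a linearisation of `Λ|_{{0} × A}`
on `A`; this file is the bookkeeping that makes «restriction along an equivariant morphism» precise for Mathlib's abstract
inverse-image pseudofunctor `Scheme.Modules.pullback`. Banked capital; HC_CM is proved only modulo the 7 printed citations
until rung 0 closes.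

Setting: two actions `ρ : ActionOver r G` on `X` and `τ : ActionOver r' G` on `S` by the same group `G`, a morphism
`ι : S ⟶ X` with `τ_g ≫ ι = ι ≫ σ_g` for all `g` (`hι`), and an `𝒪_X`-module `E`.

* §0 unit-section formulas for the structural isomorphisms of ★ `Modules/EquivariantStructure` (`pullbackMulIso`,
  `pullbackOneIso`) and for `pullbackComp.hom`;
* §1 `squareHom hsq E : b^* ι^* E ⟶ ι'^* a^* E` — the canonical comparison for a commuting square `b ≫ ι = ι' ≫ a`
  (`pullbackComp ≫ pullbackCongr ≫ pullbackComp⁻¹`), with its value on pulled-back sections (`squareHom_app_unitSection`)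
  and its naturality in `E`;
* §2 `restrictAlong ρ τ ι hι E g ψ : τ_g^* ι^* E ⟶ ι^* E` — the restriction of a would-be structure morphism
  `ψ : σ_g^* E ⟶ E` along `ι`; it is `Γ`-linear in `ψ` (`restrictAlong_comp_globalScalar`-type lemmas are left to the
  consumer; here: additivity is not needed) and, for `E` finite locally free, COMPATIBLE WITH THE UNIT AND COCYCLE
  OPERATIONS: `restrictAlong_pullbackOneIso` (`R_1(can_X) = can_S`) and **`restrictAlong_mul`**
  (`R_{gh}(can ≫ σ_h^* ψ_g ≫ ψ_h) = can ≫ τ_h^*(R_g ψ_g) ≫ R_h ψ_h`);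
* §3 **`EquivariantStructure.restrict`** — hence a `G`-linearisation `Φ` of a finite locally free `E` restricts to a
  `G`-linearisation of `ι^* E` for `τ` ([MumfordFogartyKirwan1994] Ch. 1 §3: `G`-linearised sheaves pull back along
  `G`-morphisms).

Method: morphisms out of an inverse image of a finite locally free module are determined by their values on the pulled-back
frame sections `η(b_i)` (★ `Modules/PullbackFrame.pullbackFrame`, ★ `hom_ext_of_basisSection`), on which every structural
isomorphism is computed by the ★ unit-section formulas of `Modules/PullbackAffineChart` / `HodgeTheory/CotangentSheafPullbackHom`.
-- TODO(general form): the same statements hold for every `𝒪_X`-module `E` (coherence of the inverse-image pseudofunctor);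
-- the frame argument below needs `E` finite locally free, which is the case of line bundles used downstream.

## References

* [MumfordFogartyKirwan1994] D. Mumford, J. Fogarty, F. Kirwan, *Geometric Invariant Theory*, 3rd ed., Ch. 1 §3 Def. 1.6
  (p. 30) and the remarks following it (pull-back of `G`-linearisations along `G`-morphisms).
* [MumfordAV1970] D. Mumford, *Abelian Varieties* (1970), §8 pp. 78–80 (normalisation along `{0} × X`).
* [Hartshorne1977] R. Hartshorne, *Algebraic Geometry*, II.5 (p. 110) (`f^*`, pulled-back sections).
-/

noncomputable section

-- `TopCat.Presheaf`/`Scheme.Modules` are not reducible (as in Mathlib's `AlgebraicGeometry/Modules`).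
set_option backward.isDefEq.respectTransparency false

open CategoryTheory AlgebraicGeometry Opposite TopologicalSpace

universe u

namespace Literature.AlgebraicGeometry.RelativeSpec

open Literature.AlgebraicGeometry.Modules Literature.AlgebraicGeometry.Motives
open Literature.AlgebraicGeometry.HodgeTheory

/-! ### §0 Unit-section formulas for the structural isomorphisms -/

section UnitSectionFormulas

variable {X Y Z : Scheme.{u}}

/-- `pullbackComp` sends `η_g(η_f(m))` to `η_{g ≫ f}(m)`. [cite: Hartshorne1977, II.5 (p. 110)] -/
theorem pullbackComp_hom_app_unitSection (g : X ⟶ Y) (f : Y ⟶ Z) (M : Z.Modules) (V : Z.Opens) (m : Γ(M, V)) :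
    ((Scheme.Modules.pullbackComp g f).hom.app M).app (g ⁻¹ᵁ (f ⁻¹ᵁ V))
        (unitSection g ((Scheme.Modules.pullback f).obj M) (f ⁻¹ᵁ V) (unitSection f M V m)) =
      unitSection (g ≫ f) M V m := by
  rw [← pullbackComp_inv_app_unitSection, ← CategoryTheory.comp_apply, ← Scheme.Modules.Hom.comp_app,
    ← NatTrans.comp_app, Iso.inv_hom_id, NatTrans.id_app, Scheme.Modules.Hom.id_app, CategoryTheory.id_apply]

variable {r : X ⟶ Y} {G : Type*} [Group G] (ρ : ActionOver r G)

/-- `pullbackMulIso` sends `η_{σ_{gh}}(m)` to `η_{σ_h}(η_{σ_g}(m))` (transported along `σ_{gh} = σ_h ≫ σ_g`).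
[cite: MumfordFogartyKirwan1994, Ch. 1 §3 Definition 1.6 (p. 30)] -/
theorem pullbackMulIso_hom_app_unitSection (g h : G) (E : X.Modules) (V : X.Opens) (m : Γ(E, V)) :
    (ρ.pullbackMulIso g h E).hom.app (ρ.autHom (g * h) ⁻¹ᵁ V) (unitSection (ρ.autHom (g * h)) E V m) =
      ((Scheme.Modules.pullback (ρ.autHom h)).obj ((Scheme.Modules.pullback (ρ.autHom g)).obj E)).presheaf.map
        (eqToHom (by rw [ρ.autHom_mul]; rfl)).op
        (unitSection (ρ.autHom h) ((Scheme.Modules.pullback (ρ.autHom g)).obj E) (ρ.autHom g ⁻¹ᵁ V)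
          (unitSection (ρ.autHom g) E V m)) := by
  simp only [ActionOver.pullbackMulIso, Iso.trans_hom, Iso.app_hom, Iso.symm_hom, Iso.app_inv,
    Scheme.Modules.Hom.comp_app, CategoryTheory.comp_apply]
  rw [pullbackCongr_hom_app_unitSection E (ρ.autHom_mul g h), Scheme.Modules.Hom.app_map_apply]
  have key : ((Scheme.Modules.pullbackComp (ρ.autHom h) (ρ.autHom g)).inv.app E).app
      ((ρ.autHom h ≫ ρ.autHom g) ⁻¹ᵁ V) (unitSection (ρ.autHom h ≫ ρ.autHom g) E V m) =
      unitSection (ρ.autHom h) ((Scheme.Modules.pullback (ρ.autHom g)).obj E) (ρ.autHom g ⁻¹ᵁ V)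
        (unitSection (ρ.autHom g) E V m) :=
    pullbackComp_inv_app_unitSection (ρ.autHom g) E (ρ.autHom h) V m
  exact (congrArg (((Scheme.Modules.pullback (ρ.autHom h)).obj
    ((Scheme.Modules.pullback (ρ.autHom g)).obj E)).presheaf.map (eqToHom _).op) key).trans (presheaf_map_congr _ _ _ _)

/-- `pullbackOneIso` sends `η_{σ_1}(m)` to `m` (transported along `σ_1 = 𝟙`).
[cite: MumfordFogartyKirwan1994, Ch. 1 §3 Definition 1.6 (p. 30)] -/
theorem pullbackOneIso_hom_app_unitSection (E : X.Modules) (V : X.Opens) (m : Γ(E, V)) :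
    (ρ.pullbackOneIso E).hom.app (ρ.autHom 1 ⁻¹ᵁ V) (unitSection (ρ.autHom 1) E V m) =
      E.presheaf.map (eqToHom (by rw [ρ.autHom_one]; rfl)).op m := by
  simp only [ActionOver.pullbackOneIso, Iso.trans_hom, Iso.app_hom, Scheme.Modules.Hom.comp_app,
    CategoryTheory.comp_apply]
  rw [pullbackCongr_hom_app_unitSection E ρ.autHom_one, Scheme.Modules.Hom.app_map_apply]
  have key : ((Scheme.Modules.pullbackId X).hom.app E).app ((𝟙 X) ⁻¹ᵁ V) (unitSection (𝟙 X) E V m) = m :=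
    pullbackId_hom_app_unitSection E V m
  exact (congrArg (E.presheaf.map (eqToHom _).op) key).trans (presheaf_map_congr _ _ _ _)

end UnitSectionFormulas

/-! ### §1 The comparison `b^* ι^* E ≅ ι'^* a^* E` of a commuting square `b ≫ ι = ι' ≫ a` -/

section Square

variable {S S' X X' : Scheme.{u}} {b : S' ⟶ S} {ι : S ⟶ X} {ι' : S' ⟶ X'} {a : X' ⟶ X} (hsq : b ≫ ι = ι' ≫ a)

/-- **The canonical isomorphism `b^* ι^* E ≅ ι'^* a^* E` of a commuting square `b ≫ ι = ι' ≫ a`**: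
`b^* ι^* E ≅ (b ≫ ι)^* E = (ι' ≫ a)^* E ≅ ι'^* a^* E` (Mathlib `pullbackComp`, `pullbackCongr`). Plumbing (an
isomorphism of modules; no `Prop` asserted). [cite: Hartshorne1977, II.5 (p. 110)] -/
def squareIso (E : X.Modules) :
    (Scheme.Modules.pullback b).obj ((Scheme.Modules.pullback ι).obj E) ≅
      (Scheme.Modules.pullback ι').obj ((Scheme.Modules.pullback a).obj E) :=
  (Scheme.Modules.pullbackComp b ι).app E ≪≫ (Scheme.Modules.pullbackCongr hsq).app E ≪≫
    ((Scheme.Modules.pullbackComp ι' a).app E).symm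

/-- Naturality of `squareIso` in the module. [cite: Hartshorne1977, II.5 (p. 110)] -/
@[reassoc]
theorem squareIso_hom_naturality {E F : X.Modules} (φ : E ⟶ F) :
    (Scheme.Modules.pullback b).map ((Scheme.Modules.pullback ι).map φ) ≫ (squareIso hsq F).hom =
      (squareIso hsq E).hom ≫ (Scheme.Modules.pullback ι').map ((Scheme.Modules.pullback a).map φ) := by
  have h₁ := (Scheme.Modules.pullbackComp b ι).hom.naturality φ
  have h₂ := (Scheme.Modules.pullbackCongr hsq).hom.naturality φ
  have h₃ := (Scheme.Modules.pullbackComp ι' a).inv.naturality φ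
  simp only [Functor.comp_map] at h₁ h₃
  simp only [squareIso, Iso.trans_hom, Iso.app_hom, Iso.symm_hom, Iso.app_inv, Category.assoc]
  rw [reassoc_of% h₁, reassoc_of% h₂, h₃]

/-- **`squareIso` on pulled-back sections**: `η_b(η_ι(m)) ↦ η_{ι'}(η_a(m))` (transported along
`b⁻¹ι⁻¹U = ι'⁻¹a⁻¹U`). [cite: Hartshorne1977, II.5 (p. 110)] -/
theorem squareIso_hom_app_unitSection (E : X.Modules) (U : X.Opens) (m : Γ(E, U)) :
    (squareIso hsq E).hom.app (b ⁻¹ᵁ (ι ⁻¹ᵁ U))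
        (unitSection b ((Scheme.Modules.pullback ι).obj E) (ι ⁻¹ᵁ U) (unitSection ι E U m)) =
      ((Scheme.Modules.pullback ι').obj ((Scheme.Modules.pullback a).obj E)).presheaf.map
        (eqToHom (show b ⁻¹ᵁ (ι ⁻¹ᵁ U) = ι' ⁻¹ᵁ (a ⁻¹ᵁ U) by
          rw [← Scheme.Hom.comp_preimage, ← Scheme.Hom.comp_preimage, hsq])).op
        (unitSection ι' ((Scheme.Modules.pullback a).obj E) (a ⁻¹ᵁ U) (unitSection a E U m)) := by
  simp only [squareIso, Iso.trans_hom, Iso.app_hom, Iso.symm_hom, Iso.app_inv, Scheme.Modules.Hom.comp_app,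
    CategoryTheory.comp_apply]
  erw [pullbackComp_hom_app_unitSection b ι E U m]
  -- `pullbackCongr` step
  have k₂ : ((Scheme.Modules.pullbackCongr hsq).hom.app E).app (b ⁻¹ᵁ (ι ⁻¹ᵁ U)) (unitSection (b ≫ ι) E U m) =
      ((Scheme.Modules.pullback (ι' ≫ a)).obj E).presheaf.map
        (eqToHom (show (b ≫ ι) ⁻¹ᵁ U = (ι' ≫ a) ⁻¹ᵁ U by rw [hsq])).op (unitSection (ι' ≫ a) E U m) :=
    pullbackCongr_hom_app_unitSection E hsq U m
  refine (congrArg (fun y => ((Scheme.Modules.pullbackComp ι' a).inv.app E).app (b ⁻¹ᵁ (ι ⁻¹ᵁ U)) y) k₂).trans ?_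
  -- naturality of `pullbackComp⁻¹` with respect to the transport, then its unit-section formula
  refine (Scheme.Modules.Hom.app_map_apply ((Scheme.Modules.pullbackComp ι' a).inv.app E) _
    (unitSection (ι' ≫ a) E U m)).trans ?_
  have k₄ : ((Scheme.Modules.pullbackComp ι' a).inv.app E).app ((ι' ≫ a) ⁻¹ᵁ U) (unitSection (ι' ≫ a) E U m) =
      unitSection ι' ((Scheme.Modules.pullback a).obj E) (a ⁻¹ᵁ U) (unitSection a E U m) :=
    pullbackComp_inv_app_unitSection a E ι' U m
  exact (congrArg (((Scheme.Modules.pullback ι').obj ((Scheme.Modules.pullback a).obj E)).presheaf.map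
    (eqToHom _).op) k₄).trans (presheaf_map_congr _ _ _ _)

end Square

/-! ### §1b Morphisms out of the inverse image of a finite locally free module are determined by the pulled-back frames -/

section HomExt

variable {T S : Scheme.{u}} (f : T ⟶ S) {M : S.Modules} {N : T.Modules}

/-- **Two morphisms `f^* M ⟶ N` agreeing on the pulled-back frame sections `η(b_i)` of a family of frames of `M`
covering `S` are equal** (the `η(b_i)` form a frame of `f^*M` over `f⁻¹U`, ★ `Modules/PullbackFrame`; equality of
sections is local). [cite: Hartshorne1977, II.5 (p. 110)] -/
theorem pullback_hom_ext_of_frames {A : Type*} (U : A → S.Opens) (hU : ∀ s : S, ∃ x, s ∈ U x) {I : A → Type u}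
    [∀ x, Fintype (I x)] (e : ∀ x, SheafOfModules.free (I x) ≅ M.over (U x))
    {φ₁ φ₂ : (Scheme.Modules.pullback f).obj M ⟶ N}
    (h : ∀ x i, φ₁.app (f ⁻¹ᵁ U x) (unitSection f M (U x) (basisSection (e x) i)) =
      φ₂.app (f ⁻¹ᵁ U x) (unitSection f M (U x) (basisSection (e x) i))) :
    φ₁ = φ₂ := by
  -- the restrictions to the opens `f⁻¹U_x` agree (frame argument)
  have hres : ∀ x, (SheafOfModules.overFunctor _ (f ⁻¹ᵁ U x)).map φ₁ =
      (SheafOfModules.overFunctor _ (f ⁻¹ᵁ U x)).map φ₂ := by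
    intro x
    refine hom_ext_of_basisSection (pullbackFrame f (e x)) fun i => ?_
    rw [appLE_over_map, appLE_over_map, basisSection_pullbackFrame]
    exact h x i
  refine Scheme.Modules.hom_ext _ _ fun V => ?_
  ext s
  refine TopCat.Sheaf.eq_of_locally_eq' (C := AddCommGrpCat.{u}) ⟨N.presheaf, N.isSheaf⟩
    (fun x : A => V ⊓ f ⁻¹ᵁ U x) V (fun x => homOfLE inf_le_left) (fun t ht => ?_) _ _ fun x => ?_
  · obtain ⟨x, hx⟩ := hU (f.base t)
    exact Opens.mem_iSup.mpr ⟨x, ht, hx⟩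
  · change N.presheaf.map (homOfLE (inf_le_left : V ⊓ f ⁻¹ᵁ U x ≤ V)).op (φ₁.app V s) =
      N.presheaf.map (homOfLE (inf_le_left : V ⊓ f ⁻¹ᵁ U x ≤ V)).op (φ₂.app V s)
    rw [← Scheme.Modules.Hom.app_map_apply, ← Scheme.Modules.Hom.app_map_apply,
      ← appLE_over_map φ₁ (homOfLE (inf_le_right : V ⊓ f ⁻¹ᵁ U x ≤ f ⁻¹ᵁ U x)),
      ← appLE_over_map φ₂ (homOfLE (inf_le_right : V ⊓ f ⁻¹ᵁ U x ≤ f ⁻¹ᵁ U x)), hres x]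

end HomExt

/-! ### §2 Restriction of structure morphisms along an equivariant morphism -/

section Restrict

variable {X Y S Y' : Scheme.{u}} {r : X ⟶ Y} {r' : S ⟶ Y'} {G : Type*} [Group G]
  (ρ : ActionOver r G) (τ : ActionOver r' G) (ι : S ⟶ X) (hι : ∀ g : G, τ.autHom g ≫ ι = ι ≫ ρ.autHom g)
  (E : X.Modules)

/-- **Restriction along the equivariant morphism `ι`** of a would-be structure morphism `ψ : σ_g^* E ⟶ E`:
`τ_g^* ι^* E ≅ ι^* σ_g^* E →(ι^*ψ) ι^* E`. Plumbing (a morphism of modules; no `Prop` asserted).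
[cite: MumfordFogartyKirwan1994, Ch. 1 §3 Definition 1.6 (p. 30)] -/
def restrictAlong (g : G) (ψ : (Scheme.Modules.pullback (ρ.autHom g)).obj E ⟶ E) :
    (Scheme.Modules.pullback (τ.autHom g)).obj ((Scheme.Modules.pullback ι).obj E) ⟶
      (Scheme.Modules.pullback ι).obj E :=
  (squareIso (hι g) E).hom ≫ (Scheme.Modules.pullback ι).map ψ

/-- `restrictAlong` is compatible with composition on the right: `R(ψ ≫ χ) = R(ψ) ≫ ι^*χ` for `χ : E ⟶ E`.
[cite: MumfordFogartyKirwan1994, Ch. 1 §3 Definition 1.6 (p. 30)] -/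
theorem restrictAlong_comp (g : G) (ψ : (Scheme.Modules.pullback (ρ.autHom g)).obj E ⟶ E) (χ : E ⟶ E) :
    restrictAlong ρ τ ι hι E g (ψ ≫ χ) = restrictAlong ρ τ ι hι E g ψ ≫ (Scheme.Modules.pullback ι).map χ := by
  rw [restrictAlong, restrictAlong, Functor.map_comp, Category.assoc]

/-- `restrictAlong` on pulled-back frame sections: `R(ψ)(η_{τ_g}(η_ι(m))) = η_ι(ψ(η_{σ_g}(m)))` (transported).
[cite: MumfordFogartyKirwan1994, Ch. 1 §3 Definition 1.6 (p. 30)] -/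
theorem restrictAlong_app_unitSection (g : G) (ψ : (Scheme.Modules.pullback (ρ.autHom g)).obj E ⟶ E)
    (U : X.Opens) (m : Γ(E, U)) :
    (restrictAlong ρ τ ι hι E g ψ).app (τ.autHom g ⁻¹ᵁ (ι ⁻¹ᵁ U))
        (unitSection (τ.autHom g) ((Scheme.Modules.pullback ι).obj E) (ι ⁻¹ᵁ U) (unitSection ι E U m)) =
      ((Scheme.Modules.pullback ι).obj E).presheaf.map
        (eqToHom (show τ.autHom g ⁻¹ᵁ (ι ⁻¹ᵁ U) = ι ⁻¹ᵁ (ρ.autHom g ⁻¹ᵁ U) by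
          rw [← Scheme.Hom.comp_preimage, ← Scheme.Hom.comp_preimage, hι g])).op
        (unitSection ι E (ρ.autHom g ⁻¹ᵁ U) (ψ.app (ρ.autHom g ⁻¹ᵁ U) (unitSection (ρ.autHom g) E U m))) := by
  simp only [restrictAlong, Scheme.Modules.Hom.comp_app, CategoryTheory.comp_apply]
  rw [squareIso_hom_app_unitSection]
  refine (Scheme.Modules.Hom.app_map_apply ((Scheme.Modules.pullback ι).map ψ) _ _).trans ?_
  have k : ((Scheme.Modules.pullback ι).map ψ).app (ι ⁻¹ᵁ (ρ.autHom g ⁻¹ᵁ U))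
      (unitSection ι ((Scheme.Modules.pullback (ρ.autHom g)).obj E) (ρ.autHom g ⁻¹ᵁ U)
        (unitSection (ρ.autHom g) E U m)) =
      unitSection ι E (ρ.autHom g ⁻¹ᵁ U) (ψ.app (ρ.autHom g ⁻¹ᵁ U) (unitSection (ρ.autHom g) E U m)) :=
    pullback_map_app_unitSection ι ψ _ _
  exact (congrArg (((Scheme.Modules.pullback ι).obj E).presheaf.map (eqToHom _).op) k).trans
    (presheaf_map_congr _ _ _ _)

end Restrict

/-! ### §2b Compatibility of `restrictAlong` with the unit and the cocycle operations -/

section RestrictLaws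

variable {X Y S Y' : Scheme.{u}} {r : X ⟶ Y} {r' : S ⟶ Y'} {G : Type*} [Group G]
  (ρ : ActionOver r G) (τ : ActionOver r' G) (ι : S ⟶ X) (hι : ∀ g : G, τ.autHom g ≫ ι = ι ≫ ρ.autHom g)
  {E : X.Modules} (hE : IsFiniteLocallyFree E)

/-- Two restriction maps of a sheaf of modules with the same source and target agree, through an intermediate open.
[cite: Hartshorne1977, II.1 (p. 61)] -/
theorem presheaf_map_map_eq {T : Scheme.{u}} (N : T.Modules) {W₁ W₂ W₃ : T.Opens} (i : W₂ ⟶ W₁) (j : W₃ ⟶ W₂)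
    (k : W₃ ⟶ W₁) (x : Γ(N, W₁)) :
    N.presheaf.map j.op (N.presheaf.map i.op x) = N.presheaf.map k.op x := by
  rw [← CategoryTheory.comp_apply, ← Functor.map_comp, ← op_comp]
  exact presheaf_map_congr N _ _ x

include hE in
/-- **`R_1(can_X) = can_S`**: the restriction along `ι` of the canonical `σ_1^* E ≅ E` is the canonical
`τ_1^* ι^* E ≅ ι^* E` (for `E` finite locally free). [cite: MumfordFogartyKirwan1994, Ch. 1 §3 Definition 1.6 (p. 30)] -/
theorem restrictAlong_pullbackOneIso :
    restrictAlong ρ τ ι hι E 1 (ρ.pullbackOneIso E).hom =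
      (τ.pullbackOneIso ((Scheme.Modules.pullback ι).obj E)).hom := by
  classical
  let F := frameSystemOfIsFiniteLocallyFree hE
  letI : ∀ x, Fintype (F.I x) := fun x => Fintype.ofEquiv _ (F.enum x).symm
  refine pullback_hom_ext_of_frames (τ.autHom 1) (fun x => ι ⁻¹ᵁ F.U x) (fun s => ⟨ι.base s, F.mem _⟩)
    (fun x => pullbackFrame ι (F.frame x)) fun x i => ?_
  rw [basisSection_pullbackFrame, restrictAlong_app_unitSection, pullbackOneIso_hom_app_unitSection,
    pullbackOneIso_hom_app_unitSection, unitSection_map]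
  simp only [← CategoryTheory.comp_apply, ← Functor.map_comp]
  exact presheaf_map_congr _ _ _ _

include hE in
/-- **`R_{gh}(can ≫ σ_h^* ψ_g ≫ ψ_h) = can ≫ τ_h^*(R_g ψ_g) ≫ R_h ψ_h`**: restriction along the equivariant `ι` is
compatible with the cocycle composition of would-be structure morphisms (for `E` finite locally free). Both sides
send the pulled-back frame section `η_{τ_{gh}}(η_ι(b))` to (a restriction of) `η_ι(ψ_h(η_{σ_h}(ψ_g(η_{σ_g}(b)))))`.
[cite: MumfordFogartyKirwan1994, Ch. 1 §3 Definition 1.6 (p. 30)] -/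
theorem restrictAlong_mul (g h : G) (ψg : (Scheme.Modules.pullback (ρ.autHom g)).obj E ⟶ E)
    (ψh : (Scheme.Modules.pullback (ρ.autHom h)).obj E ⟶ E) :
    restrictAlong ρ τ ι hι E (g * h)
        ((ρ.pullbackMulIso g h E).hom ≫ (Scheme.Modules.pullback (ρ.autHom h)).map ψg ≫ ψh) =
      (τ.pullbackMulIso g h ((Scheme.Modules.pullback ι).obj E)).hom ≫
        (Scheme.Modules.pullback (τ.autHom h)).map (restrictAlong ρ τ ι hι E g ψg) ≫
          restrictAlong ρ τ ι hι E h ψh := by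
  classical
  let F := frameSystemOfIsFiniteLocallyFree hE
  letI : ∀ x, Fintype (F.I x) := fun x => Fintype.ofEquiv _ (F.enum x).symm
  refine pullback_hom_ext_of_frames (τ.autHom (g * h)) (fun x => ι ⁻¹ᵁ F.U x) (fun s => ⟨ι.base s, F.mem _⟩)
    (fun x => pullbackFrame ι (F.frame x)) fun x i => ?_
  set b := basisSection (F.frame x) i
  set z : Γ(E, ρ.autHom g ⁻¹ᵁ F.U x) := ψg.app (ρ.autHom g ⁻¹ᵁ F.U x) (unitSection (ρ.autHom g) E (F.U x) b)
  rw [basisSection_pullbackFrame]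
  -- the left-hand side
  rw [restrictAlong_app_unitSection, Scheme.Modules.Hom.comp_app, Scheme.Modules.Hom.comp_app,
    CategoryTheory.comp_apply, CategoryTheory.comp_apply, pullbackMulIso_hom_app_unitSection,
    Scheme.Modules.Hom.app_map_apply]
  erw [pullback_map_app_unitSection (ρ.autHom h) ψg]
  rw [Scheme.Modules.Hom.app_map_apply, unitSection_map]
  -- the right-hand side
  rw [Scheme.Modules.Hom.comp_app, Scheme.Modules.Hom.comp_app, CategoryTheory.comp_apply,
    CategoryTheory.comp_apply, pullbackMulIso_hom_app_unitSection, Scheme.Modules.Hom.app_map_apply,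
    pullback_map_app_unitSection (τ.autHom h) (restrictAlong ρ τ ι hι E g ψg),
    restrictAlong_app_unitSection ρ τ ι hι E g ψg (F.U x) b, unitSection_map, Scheme.Modules.Hom.app_map_apply,
    Scheme.Modules.Hom.app_map_apply, restrictAlong_app_unitSection ρ τ ι hι E h ψh (ρ.autHom g ⁻¹ᵁ F.U x) z]
  -- both sides are restrictions of the same section
  simp only [← CategoryTheory.comp_apply, ← Functor.map_comp]
  exact presheaf_map_congr _ _ _ _

end RestrictLaws

/-! ### §3 Restriction of `G`-linearisations -/

section Structure

variable {X Y S Y' : Scheme.{u}} {r : X ⟶ Y} {r' : S ⟶ Y'} {G : Type*} [Group G]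
  {ρ : ActionOver r G} (τ : ActionOver r' G) (ι : S ⟶ X) (hι : ∀ g : G, τ.autHom g ≫ ι = ι ≫ ρ.autHom g)
  {E : X.Modules} (hE : IsFiniteLocallyFree E)

/-- `restrictAlong` of an isomorphism, as an isomorphism. Plumbing. [cite: MumfordFogartyKirwan1994, Ch. 1 §3 Definition 1.6 (p. 30)] -/
def restrictAlongIso (g : G) (ψ : (Scheme.Modules.pullback (ρ.autHom g)).obj E ≅ E) :
    (Scheme.Modules.pullback (τ.autHom g)).obj ((Scheme.Modules.pullback ι).obj E) ≅
      (Scheme.Modules.pullback ι).obj E :=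
  squareIso (hι g) E ≪≫ (Scheme.Modules.pullback ι).mapIso ψ

/-- Unfolding `restrictAlongIso`. [cite: MumfordFogartyKirwan1994, Ch. 1 §3 Definition 1.6 (p. 30)] -/
@[simp]
theorem restrictAlongIso_hom (g : G) (ψ : (Scheme.Modules.pullback (ρ.autHom g)).obj E ≅ E) :
    (restrictAlongIso τ ι hι g ψ).hom = restrictAlong ρ τ ι hι E g ψ.hom := rfl

/-- **A `G`-linearisation restricts along an equivariant morphism**: for `τ_g ≫ ι = ι ≫ σ_g` and a `G`-linearisation
`Φ` of a finite locally free `E` for `ρ`, the isomorphisms `τ_g^* ι^* E ≅ ι^* σ_g^* E →(ι^*Φ_g) ι^* E` form a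
`G`-linearisation of `ι^* E` for `τ` ([MFK94] Ch. 1 §3: `G`-linearised sheaves pull back along `G`-morphisms).
[cite: MumfordFogartyKirwan1994, Ch. 1 §3 Definition 1.6 (p. 30)] -/
def ActionOver.EquivariantStructure.restrict (Φ : ρ.EquivariantStructure E) :
    τ.EquivariantStructure ((Scheme.Modules.pullback ι).obj E) where
  iso g := restrictAlongIso τ ι hι g (Φ.iso g)
  iso_one := by
    ext : 1
    rw [restrictAlongIso_hom, Φ.iso_one]
    exact restrictAlong_pullbackOneIso ρ τ ι hι hE
  iso_mul g h := by
    ext : 1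
    rw [restrictAlongIso_hom, Φ.iso_mul]
    simp only [Iso.trans_hom, Functor.mapIso_hom, restrictAlongIso_hom]
    exact restrictAlong_mul ρ τ ι hι hE g h (Φ.iso g).hom (Φ.iso h).hom

/-- The structure isomorphisms of the restricted linearisation. [cite: MumfordFogartyKirwan1994, Ch. 1 §3 Definition 1.6 (p. 30)] -/
@[simp]
theorem ActionOver.EquivariantStructure.restrict_iso_hom (Φ : ρ.EquivariantStructure E) (g : G) :
    ((Φ.restrict τ ι hι hE).iso g).hom = restrictAlong ρ τ ι hι E g (Φ.iso g).hom := rfl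

end Structure

/-! ### §4 Transport of linearisations between actions with the same automorphisms -/

section SameAut

variable {X Y Y' : Scheme.{u}} {r : X ⟶ Y} {r' : X ⟶ Y'} {G : Type*} [Group G]

/-- **A `G`-linearisation only depends on the automorphisms by which `G` acts**: if `ρ : ActionOver r G` and
`ρ' : ActionOver r' G` (possibly over different bases) have the same `aut : G →* Aut X`, a linearisation for `ρ`
is a linearisation for `ρ'` (all structure isomorphisms live over `σ_g = (aut g).hom`). Plumbing.
[cite: MumfordFogartyKirwan1994, Ch. 1 §3 Definition 1.6 (p. 30)] -/
def ActionOver.EquivariantStructure.ofAutEq {ρ : ActionOver r G} {ρ' : ActionOver r' G} (h : ρ'.aut = ρ.aut)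
    {E : X.Modules} (Φ : ρ.EquivariantStructure E) : ρ'.EquivariantStructure E := by
  obtain ⟨aut', haut'⟩ := ρ'
  cases h
  exact ⟨Φ.iso, Φ.iso_one, Φ.iso_mul⟩

end SameAut

end Literature.AlgebraicGeometry.RelativeSpec

end
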